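import Summits.AtomisticToContinuum.FouriersLaw.Theorems.PhononMeanFreePathCoherentDephasingKickDuhamel
import Summits.AtomisticToContinuum.FouriersLaw.Theorems.PhononMeanFreePathCoherentDephasingResponseStatics

/-!
# `CoherentDephasing` / line `Sketch`: the mean-field (Duhamel) equations of the coherent response field

Stub `stub_meanFieldDuhamel` (file 3/3) of line `Sketch` (coherent-field Beer–Lambert) of crux
`stmt-AtomisticToContinuum-11810` (`PhononMeanFreePath.CoherentDephasing`). For the `(N+1)`-site pinned anharmonic chain
`P = pinnedChain ω₂ lam β γ` (all parameters `> 0`) with both Langevin baths at `T > 0`, Gibbs law `μ_T`, constructed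
kernels `K_t` and the response field of the kick at `p₀` (`Theorems/PhononMeanFreePathDefs`: `posResp` `n_x = ⟨p₀,K_t q_x⟩`,
`momResp` `m_x = ⟨p₀,K_t p_x⟩`, `cubeResp` `c_x`, `bondForceResp` `F_b`), for every `t ≥ 0`:

  `n_x(t) = ∫₀ᵗ m_x`,
  `m_x(t) = T [x = 0] + ∫₀ᵗ ( -ω₂ n_x - lam c_x + Σ_b ([b = x] - [b+1 = x]) F_b - γ ([x = 0] + [x = N]) m_x )`.

Proof: Duhamel's formula `kickResp g t - ∫ p₀ g dμ_T = ∫₀ᵗ kickResp (L g)` (file 1, `kickResp_duhamel`) for `g = q_x`,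
`p_x` with the generator images and statics of file 2, and linearity of `g ↦ kickResp g s` on continuous `O((1+H)²)`
observables (proved here: each such `g` is `K_s(z,·)`-integrable and `p₀ · K_s g ∈ L¹(μ_T)`).
-/

noncomputable section

open MeasureTheory Filter Topology Set

namespace Summit.AtomisticToContinuum.FouriersLaw.Theorems.CoherentDephasing.MeanFieldDuhamel

open Literature.MathematicalPhysics.KineticTheory.HeatConduction
open Literature.MathematicalPhysics.KineticTheory OscillatorChain
open Summit.AtomisticToContinuum.FouriersLaw.Theorems.SubdiffusiveBondHeat
open Summit.AtomisticToContinuum.FouriersLaw.Theorems.PhononMeanFreePath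

/-! ### Linearity of the kick response on `O((1+H)²)` observables -/

section Linearity

variable {ω₂ lam β γ : ℝ} (hω : 0 < ω₂) (hl : 0 ≤ lam) (hβ : 0 < β) (hγ : 0 < γ) {T : ℝ} (hT : 0 < T) (N : ℕ)
include hω hl hβ hγ hT

/-- A continuous `O((1+H)²)` observable `g` is integrable for every kernel `K_t(z, ·)`, and `p₀ · (K_t g) ∈ L¹(μ_T)`
(`(1+H)² ≤ C e^{H/(4T)}`; CEHR (3.4) for the kernels; `pinnedChain_integrable_weight_mul_act` for the pairing).
[folklore] -/
theorem kick_integrable {g : PhaseSpace (N + 1) → ℝ} (hg : Continuous g) {C : ℝ}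
    (hgb : ∀ y, |g y| ≤ C * (1 + (pinnedChain ω₂ lam β γ).hamiltonian (N + 1) y) ^ 2) (t : ℝ) :
    (∀ z, Integrable g ((pinnedChain ω₂ lam β γ).transitionKernel (N + 1) T T t.toNNReal z)) ∧
    Integrable (fun z : PhaseSpace (N + 1) => z.2 0 *
        ∫ y, g y ∂((pinnedChain ω₂ lam β γ).transitionKernel (N + 1) T T t.toNNReal z))
      ((pinnedChain ω₂ lam β γ).gibbsMeasure (N + 1) T) := by
  have hN : 0 < N + 1 := Nat.succ_pos N
  set ϑ : ℝ := 1 / (4 * T) with hϑ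
  have hϑ0 : 0 < ϑ := by positivity
  have h2ϑ : 2 * ϑ < 1 / T := by
    rw [hϑ, show 2 * (1 / (4 * T)) = 1 / (2 * T) by field_simp; norm_num, div_lt_div_iff₀ (by positivity) hT]
    nlinarith
  have hϑ1 : ϑ < 1 / T := by linarith
  have hH0 : ∀ y, 0 ≤ (pinnedChain ω₂ lam β γ).hamiltonian (N + 1) y := fun y =>
    pinnedChain_hamiltonian_nonneg hω.le hl hβ.le γ (N + 1) y
  have hC0 : 0 ≤ C := by
    have h := hgb 0
    have hW : 0 < (1 + (pinnedChain ω₂ lam β γ).hamiltonian (N + 1) 0) ^ 2 := by have := hH0 0; positivity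
    nlinarith [abs_nonneg (g 0)]
  set C₀ : ℝ := 2 * Real.exp ϑ / ϑ ^ 2 with hC₀
  have hgexp : ∀ y, |g y| ≤ C * C₀ * Real.exp (ϑ * (pinnedChain ω₂ lam β γ).hamiltonian (N + 1) y) := fun y => by
    have h1 := one_add_sq_le_exp (hH0 y) hϑ0
    calc |g y| ≤ C * (1 + (pinnedChain ω₂ lam β γ).hamiltonian (N + 1) y) ^ 2 := hgb y
      _ ≤ C * (C₀ * Real.exp (ϑ * (pinnedChain ω₂ lam β γ).hamiltonian (N + 1) y)) :=
          mul_le_mul_of_nonneg_left h1 hC0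
      _ = _ := by ring
  refine ⟨fun z => integrable_of_abs_le_exp
    (pinnedChain_integrable_exp_mul_hamiltonian_transitionKernel hω hl hT hβ.le hγ.le hN hϑ0 hϑ1 _ z) hg hgexp, ?_⟩
  exact pinnedChain_integrable_weight_mul_act hω hl hβ hγ hN hT hϑ0 h2ϑ (a := fun z : PhaseSpace (N + 1) => z.2 0)
    (by fun_prop) hg (fun y => abs_momentum_le_exp hω.le hl hβ.le hϑ0 y 0) hgexp t.toNNReal

/-- Additivity of the kick response on continuous `O((1+H)²)` observables. [folklore] -/
theorem kickResp_add {f g : PhaseSpace (N + 1) → ℝ} (hf : Continuous f) (hg : Continuous g) {Cf Cg : ℝ}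
    (hfb : ∀ y, |f y| ≤ Cf * (1 + (pinnedChain ω₂ lam β γ).hamiltonian (N + 1) y) ^ 2)
    (hgb : ∀ y, |g y| ≤ Cg * (1 + (pinnedChain ω₂ lam β γ).hamiltonian (N + 1) y) ^ 2) (t : ℝ) :
    kickResp ω₂ lam β γ T N (fun y => f y + g y) t = kickResp ω₂ lam β γ T N f t + kickResp ω₂ lam β γ T N g t := by
  obtain ⟨hf1, hf2⟩ := kick_integrable hω hl hβ hγ hT N hf hfb t
  obtain ⟨hg1, hg2⟩ := kick_integrable hω hl hβ hγ hT N hg hgb t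
  unfold kickResp
  rw [← integral_add hf2 hg2]
  refine integral_congr_ae (Eventually.of_forall fun z => ?_)
  simp only
  rw [integral_add (hf1 z) (hg1 z), mul_add]

/-- The kick response of a difference of continuous `O((1+H)²)` observables. [folklore] -/
theorem kickResp_sub {f g : PhaseSpace (N + 1) → ℝ} (hf : Continuous f) (hg : Continuous g) {Cf Cg : ℝ}
    (hfb : ∀ y, |f y| ≤ Cf * (1 + (pinnedChain ω₂ lam β γ).hamiltonian (N + 1) y) ^ 2)
    (hgb : ∀ y, |g y| ≤ Cg * (1 + (pinnedChain ω₂ lam β γ).hamiltonian (N + 1) y) ^ 2) (t : ℝ) :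
    kickResp ω₂ lam β γ T N (fun y => f y - g y) t = kickResp ω₂ lam β γ T N f t - kickResp ω₂ lam β γ T N g t := by
  obtain ⟨hf1, hf2⟩ := kick_integrable hω hl hβ hγ hT N hf hfb t
  obtain ⟨hg1, hg2⟩ := kick_integrable hω hl hβ hγ hT N hg hgb t
  unfold kickResp
  rw [← integral_sub hf2 hg2]
  refine integral_congr_ae (Eventually.of_forall fun z => ?_)
  simp only
  rw [integral_sub (hf1 z) (hg1 z), mul_sub]

/-- The kick response of a finite sum of continuous `O((1+H)²)` observables. [folklore] -/
theorem kickResp_finset_sum {ι : Type*} (s : Finset ι) {f : ι → PhaseSpace (N + 1) → ℝ}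
    (hf : ∀ i ∈ s, Continuous (f i))
    (hfb : ∀ i ∈ s, ∃ C : ℝ, ∀ y, |f i y| ≤ C * (1 + (pinnedChain ω₂ lam β γ).hamiltonian (N + 1) y) ^ 2) (t : ℝ) :
    kickResp ω₂ lam β γ T N (fun y => ∑ i ∈ s, f i y) t = ∑ i ∈ s, kickResp ω₂ lam β γ T N (f i) t := by
  have hI : ∀ i ∈ s, (∀ z, Integrable (f i) ((pinnedChain ω₂ lam β γ).transitionKernel (N + 1) T T t.toNNReal z)) ∧
      Integrable (fun z : PhaseSpace (N + 1) => z.2 0 *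
        ∫ y, f i y ∂((pinnedChain ω₂ lam β γ).transitionKernel (N + 1) T T t.toNNReal z))
        ((pinnedChain ω₂ lam β γ).gibbsMeasure (N + 1) T) := fun i hi => by
    obtain ⟨C, hC⟩ := hfb i hi
    exact kick_integrable hω hl hβ hγ hT N (hf i hi) hC t
  unfold kickResp
  rw [← integral_finsetSum s (fun i hi => (hI i hi).2)]
  refine integral_congr_ae (Eventually.of_forall fun z => ?_)
  simp only
  rw [integral_finsetSum s (fun i hi => (hI i hi).1 z), Finset.mul_sum]

omit hω hl hβ hγ hT in
/-- Homogeneity of the kick response (no integrability needed). [folklore] -/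
theorem kickResp_const_mul (c : ℝ) (f : PhaseSpace (N + 1) → ℝ) (t : ℝ) :
    kickResp ω₂ lam β γ T N (fun y => c * f y) t = c * kickResp ω₂ lam β γ T N f t := by
  unfold kickResp
  rw [← integral_const_mul]
  refine integral_congr_ae (Eventually.of_forall fun z => ?_)
  simp only
  rw [integral_const_mul]
  ring

omit hω hl hβ hγ hT in
/-- The kick response commutes with negation (no integrability needed). [folklore] -/
theorem kickResp_neg (f : PhaseSpace (N + 1) → ℝ) (t : ℝ) :
    kickResp ω₂ lam β γ T N (fun y => -f y) t = -kickResp ω₂ lam β γ T N f t := by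
  unfold kickResp
  rw [← integral_neg]
  refine integral_congr_ae (Eventually.of_forall fun z => ?_)
  simp only
  rw [integral_neg]
  ring

omit hω hl hβ hγ hT in
/-- The kick response of an observable switched on by a constant condition. [folklore] -/
theorem kickResp_ite (p : Prop) [Decidable p] (f : PhaseSpace (N + 1) → ℝ) (t : ℝ) :
    kickResp ω₂ lam β γ T N (fun y => if p then f y else 0) t = if p then kickResp ω₂ lam β γ T N f t else 0 := by
  by_cases hp : p
  · simp only [if_pos hp]
  · simp only [if_neg hp]
    simp [kickResp]

end Linearity

/-! ### The stub: Duhamel form of the mean-field equations of the coherent response field -/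

section Main

/-- **Stub `stub_meanFieldDuhamel` of line `Sketch` (crux `PhononMeanFreePath.CoherentDephasing`).** For the
`(N+1)`-site pinned anharmonic chain `pinnedChain ω₂ lam β γ` (all parameters `> 0`) with both Langevin baths at
`T > 0`, the Gibbs-averaged response field of the kick at `p₀` — `n_x(t) = ⟨p₀, K_t q_x⟩`, `m_x(t) = ⟨p₀, K_t p_x⟩`
(`posResp`, `momResp` of `Theorems/PhononMeanFreePathDefs`) — satisfies for `t ≥ 0` the Duhamel (integrated Dynkin)
equations of the free-end pinned harmonic chain driven by the mean anharmonic polarisation and damped at the two bath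
momenta: `n_x(t) = ∫₀ᵗ m_x` and
`m_x(t) = T [x = 0] + ∫₀ᵗ ( -ω₂ n_x - lam c_x + Σ_b ([b = x] - [b+1 = x]) F_b - γ ([x = 0] + [x = N]) m_x )`.
Proof: `d/dt ⟨p₀, K_t g⟩ = ⟨p₀, K_t L g⟩` integrated (`kickResp_duhamel`) for `g = q_x`
(`L q_x = p_x`) and `g = p_x` (`L p_x = -∂Φ/∂q_x - γ 1_B(x) p_x`, `pinnedChain_dPotential_succ`); the statics
`⟨p₀ q_x⟩_{μ_T} = 0`, `⟨p₀ p_x⟩_{μ_T} = T δ_{x0}`; linearity of `g ↦ ⟨p₀, K_s g⟩` on `O((1+H)²)` observables.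
[folklore] -/
theorem stub_meanFieldDuhamel :
    ∀ ω₂ lam β γ : ℝ, 0 < ω₂ → 0 < lam → 0 < β → 0 < γ → ∀ T : ℝ, 0 < T → ∀ N : ℕ,
      (∀ (x : Fin (N + 1)) (t : ℝ), 0 ≤ t →
          posResp ω₂ lam β γ T N x t = ∫ s in (0 : ℝ)..t, momResp ω₂ lam β γ T N x s) ∧
      (∀ (x : Fin (N + 1)) (t : ℝ), 0 ≤ t →
          momResp ω₂ lam β γ T N x t = (if (x : ℕ) = 0 then T else 0) +
            ∫ s in (0 : ℝ)..t, (-(ω₂ * posResp ω₂ lam β γ T N x s) - lam * cubeResp ω₂ lam β γ T N x s +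
              (∑ b : Fin N, ((if (b : ℕ) = (x : ℕ) then bondForceResp ω₂ lam β γ T N b s else 0) -
                (if (b : ℕ) + 1 = (x : ℕ) then bondForceResp ω₂ lam β γ T N b s else 0))) -
              γ * ((if (x : ℕ) = 0 then 1 else 0) + (if (x : ℕ) = N then 1 else 0)) *
                momResp ω₂ lam β γ T N x s)) := by
  intro ω₂ lam β γ hω hl hβ hγ T hT N
  have hH0 : ∀ y, 0 ≤ (pinnedChain ω₂ lam β γ).hamiltonian (N + 1) y := fun y =>
    pinnedChain_hamiltonian_nonneg hω.le hl.le hβ.le γ (N + 1) y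
  have hW1 : ∀ y, 1 + (pinnedChain ω₂ lam β γ).hamiltonian (N + 1) y ≤
      (1 + (pinnedChain ω₂ lam β γ).hamiltonian (N + 1) y) ^ 2 := fun y => by
    have := hH0 y; nlinarith
  -- the coordinate observables and their sizes
  have hqc : ∀ x : Fin (N + 1), ContDiff ℝ 2 (fun y : PhaseSpace (N + 1) => y.1 x) := fun x =>
    (contDiff_apply ℝ ℝ x).comp contDiff_fst
  have hpc : ∀ x : Fin (N + 1), ContDiff ℝ 2 (fun y : PhaseSpace (N + 1) => y.2 x) := fun x =>
    (contDiff_apply ℝ ℝ x).comp contDiff_snd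
  have hqb := fun (y : PhaseSpace (N + 1)) (x : Fin (N + 1)) => abs_fst_le hω hl.le hβ.le γ y x
  have hq3b := fun (y : PhaseSpace (N + 1)) (x : Fin (N + 1)) => abs_fst_cube_le hω hl.le hβ.le γ y x
  have hpb := fun (y : PhaseSpace (N + 1)) (x : Fin (N + 1)) => abs_snd_le hl.le hβ.le γ hω.le y x
  have hFb := fun (y : PhaseSpace (N + 1)) (b : Fin N) => abs_bondForce_le hl.le hβ.le γ hω.le y b
  have hpb2 : ∀ (y : PhaseSpace (N + 1)) (x : Fin (N + 1)),
      |y.2 x| ≤ 1 * (1 + (pinnedChain ω₂ lam β γ).hamiltonian (N + 1) y) ^ 2 := fun y x => by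
    rw [one_mul]; exact (hpb y x).trans (hW1 y)
  refine ⟨fun x t ht => ?_, fun x t ht => ?_⟩
  · -- the position equation: `L q_x = p_x`, `⟨p₀ q_x⟩ = 0`
    have hgen : ∀ z, (pinnedChain ω₂ lam β γ).generator (N + 1) T T (fun y : PhaseSpace (N + 1) => y.1 x) z =
        (fun y : PhaseSpace (N + 1) => y.2 x) z := fun z => generator_fst _ T T x z
    have h := kickResp_duhamel ω₂ lam β γ hω hl.le hβ hγ T hT N _ _ (hqc x) (by fun_prop) hgen (Ce := 1 / 2 + 1 / ω₂)
      (D := 0) (B := 1) (by positivity) le_rfl zero_le_one (fun y => hqb y x)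
      (fun y => by rw [partialP_fst, abs_zero]) (fun y => by rw [partialP_fst, abs_zero]) (fun y => hpb2 y x) t ht
    rw [integral_momentum_mul_position_gibbsMeasure, sub_zero] at h
    exact h
  · -- the momentum equation: `L p_x = -∂Φ/∂q_x - γ 1_B(x) p_x`, `⟨p₀ p_x⟩ = T δ_{x0}`
    set c : ℝ := (if (x : ℕ) = 0 then (1:ℝ) else 0) + (if (x : ℕ) = N then (1:ℝ) else 0) with hc
    set F : Fin N → PhaseSpace (N + 1) → ℝ := fun b y =>
      (y.1 b.succ - y.1 b.castSucc) + β * (y.1 b.succ - y.1 b.castSucc) ^ 3 with hF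
    set S : PhaseSpace (N + 1) → ℝ := fun y =>
      ∑ b : Fin N, ((if (b : ℕ) = (x : ℕ) then F b y else 0) - (if (b : ℕ) + 1 = (x : ℕ) then F b y else 0)) with hS
    set ℓ : PhaseSpace (N + 1) → ℝ := fun y => -(ω₂ * y.1 x) - lam * y.1 x ^ 3 + S y - γ * c * y.2 x with hℓ
    -- the generator image of `p_x`
    have hgen : ∀ z, (pinnedChain ω₂ lam β γ).generator (N + 1) T T (fun y : PhaseSpace (N + 1) => y.2 x) z = ℓ z := by
      intro z
      have hU : Differentiable ℝ (pinnedChain ω₂ lam β γ).U :=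
        (pinnedChain_contDiff_U ω₂ lam β γ (n := 1)).differentiable one_ne_zero
      have hV : Differentiable ℝ (pinnedChain ω₂ lam β γ).V :=
        (pinnedChain_contDiff_V ω₂ lam β γ (n := 1)).differentiable one_ne_zero
      have hγ' : (pinnedChain ω₂ lam β γ).γ = γ := rfl
      rw [generator_snd _ hU hV T T x z, pinnedChain_dPotential_succ, hγ']
      simp only [hℓ, hS, hF, hc, Nat.add_sub_cancel]
      split_ifs <;> ring
    -- continuity and sizes of the pieces of `ℓ`
    have hq1c : Continuous fun y : PhaseSpace (N + 1) => y.1 x := by fun_prop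
    have hp1c : Continuous fun y : PhaseSpace (N + 1) => y.2 x := by fun_prop
    have hFc : ∀ b, Continuous (F b) := fun b => by simp only [hF]; fun_prop
    have hi1c : ∀ b : Fin N, Continuous fun y => (if (b : ℕ) = (x : ℕ) then F b y else 0) := fun b => by
      split_ifs
      · exact hFc b
      · exact continuous_const
    have hi2c : ∀ b : Fin N, Continuous fun y => (if (b : ℕ) + 1 = (x : ℕ) then F b y else 0) := fun b => by
      split_ifs
      · exact hFc b
      · exact continuous_const
    have hSbc : ∀ b : Fin N, Continuous fun y =>
        (if (b : ℕ) = (x : ℕ) then F b y else 0) - (if (b : ℕ) + 1 = (x : ℕ) then F b y else 0) :=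
      fun b => (hi1c b).sub (hi2c b)
    have hSc : Continuous S := by
      simp only [hS]
      exact continuous_finsetSum _ fun b _ => hSbc b
    have hA1c : Continuous fun y : PhaseSpace (N + 1) => -(ω₂ * y.1 x) - lam * y.1 x ^ 3 := by fun_prop
    have hAc : Continuous fun y : PhaseSpace (N + 1) => -(ω₂ * y.1 x) - lam * y.1 x ^ 3 + S y := hA1c.add hSc
    have hGc : Continuous fun y : PhaseSpace (N + 1) => γ * c * y.2 x := by fun_prop
    have hℓc : Continuous ℓ := hAc.sub hGc
    -- sizes, all against `W = (1+H)²`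
    have bq : ∀ y : PhaseSpace (N + 1), |-(ω₂ * y.1 x)| ≤
        ω₂ * (1 / 2 + 1 / ω₂) * (1 + (pinnedChain ω₂ lam β γ).hamiltonian (N + 1) y) ^ 2 := fun y => by
      rw [abs_neg, abs_mul, abs_of_pos hω, mul_assoc]
      exact mul_le_mul_of_nonneg_left ((hqb y x).trans (mul_le_mul_of_nonneg_left (hW1 y) (by positivity))) hω.le
    have bq3 : ∀ y : PhaseSpace (N + 1), |lam * y.1 x ^ 3| ≤
        lam * (1 / ω₂ + 2 / ω₂ ^ 2) * (1 + (pinnedChain ω₂ lam β γ).hamiltonian (N + 1) y) ^ 2 := fun y => by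
      rw [abs_mul, abs_of_pos hl, mul_assoc]
      exact mul_le_mul_of_nonneg_left (hq3b y x) hl.le
    have bi1 : ∀ (b : Fin N) (y : PhaseSpace (N + 1)), |(if (b : ℕ) = (x : ℕ) then F b y else 0)| ≤
        (3 + β) * (1 + (pinnedChain ω₂ lam β γ).hamiltonian (N + 1) y) ^ 2 := fun b y => by
      split_ifs
      · exact hFb y b
      · rw [abs_zero]; positivity
    have bi2 : ∀ (b : Fin N) (y : PhaseSpace (N + 1)), |(if (b : ℕ) + 1 = (x : ℕ) then F b y else 0)| ≤
        (3 + β) * (1 + (pinnedChain ω₂ lam β γ).hamiltonian (N + 1) y) ^ 2 := fun b y => by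
      split_ifs
      · exact hFb y b
      · rw [abs_zero]; positivity
    have bSb : ∀ (b : Fin N) (y : PhaseSpace (N + 1)),
        |(if (b : ℕ) = (x : ℕ) then F b y else 0) - (if (b : ℕ) + 1 = (x : ℕ) then F b y else 0)| ≤
        (2 * (3 + β)) * (1 + (pinnedChain ω₂ lam β γ).hamiltonian (N + 1) y) ^ 2 := fun b y => by
      have := abs_sub (if (b : ℕ) = (x : ℕ) then F b y else 0) (if (b : ℕ) + 1 = (x : ℕ) then F b y else 0)
      have := bi1 b y
      have := bi2 b y
      linarith
    have bS : ∀ y : PhaseSpace (N + 1), |S y| ≤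
        N * (2 * (3 + β)) * (1 + (pinnedChain ω₂ lam β γ).hamiltonian (N + 1) y) ^ 2 := fun y => by
      simp only [hS]
      calc _ ≤ ∑ b : Fin N, |(if (b : ℕ) = (x : ℕ) then F b y else 0) -
            (if (b : ℕ) + 1 = (x : ℕ) then F b y else 0)| := Finset.abs_sum_le_sum_abs _ _
        _ ≤ ∑ b : Fin N, (2 * (3 + β)) * (1 + (pinnedChain ω₂ lam β γ).hamiltonian (N + 1) y) ^ 2 :=
            Finset.sum_le_sum fun b _ => bSb b y
        _ = N * (2 * (3 + β)) * (1 + (pinnedChain ω₂ lam β γ).hamiltonian (N + 1) y) ^ 2 := by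
            rw [Finset.sum_const, Finset.card_univ, Fintype.card_fin, nsmul_eq_mul]; ring
    have bA1 : ∀ y : PhaseSpace (N + 1), |-(ω₂ * y.1 x) - lam * y.1 x ^ 3| ≤
        (ω₂ * (1 / 2 + 1 / ω₂) + lam * (1 / ω₂ + 2 / ω₂ ^ 2)) *
          (1 + (pinnedChain ω₂ lam β γ).hamiltonian (N + 1) y) ^ 2 := fun y => by
      have := abs_sub (-(ω₂ * y.1 x)) (lam * y.1 x ^ 3)
      have := bq y
      have := bq3 y
      linarith
    have bA : ∀ y : PhaseSpace (N + 1), |-(ω₂ * y.1 x) - lam * y.1 x ^ 3 + S y| ≤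
        (ω₂ * (1 / 2 + 1 / ω₂) + lam * (1 / ω₂ + 2 / ω₂ ^ 2) + N * (2 * (3 + β))) *
          (1 + (pinnedChain ω₂ lam β γ).hamiltonian (N + 1) y) ^ 2 := fun y => by
      have := abs_add_le (-(ω₂ * y.1 x) - lam * y.1 x ^ 3) (S y)
      have := bA1 y
      have := bS y
      linarith
    have hc2 : |c| ≤ 2 := by
      simp only [hc]; split_ifs <;> norm_num
    have bG : ∀ y : PhaseSpace (N + 1), |γ * c * y.2 x| ≤
        γ * 2 * (1 + (pinnedChain ω₂ lam β γ).hamiltonian (N + 1) y) ^ 2 := fun y => by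
      rw [abs_mul, abs_mul, abs_of_pos hγ]
      have h1 := hpb2 y x
      rw [one_mul] at h1
      exact mul_le_mul (mul_le_mul_of_nonneg_left hc2 hγ.le) h1 (abs_nonneg _) (by positivity)
    have bℓ : ∀ y : PhaseSpace (N + 1), |ℓ y| ≤
        (ω₂ * (1 / 2 + 1 / ω₂) + lam * (1 / ω₂ + 2 / ω₂ ^ 2) + N * (2 * (3 + β)) + γ * 2) *
          (1 + (pinnedChain ω₂ lam β γ).hamiltonian (N + 1) y) ^ 2 := fun y => by
      have := abs_sub (-(ω₂ * y.1 x) - lam * y.1 x ^ 3 + S y) (γ * c * y.2 x)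
      have := bA y
      have := bG y
      simp only [hℓ]
      linarith
    -- Duhamel for `p_x`
    have hd : ∀ (i : Fin (N + 1)) (y : PhaseSpace (N + 1)), |partialP i (fun y : PhaseSpace (N + 1) => y.2 x) y| ≤ 1 :=
      fun i y => by rw [partialP_snd]; split_ifs <;> simp
    have h := kickResp_duhamel ω₂ lam β γ hω hl.le hβ hγ T hT N _ _ (hpc x) hℓc hgen (Ce := 1) (D := 1)
      (B := ω₂ * (1 / 2 + 1 / ω₂) + lam * (1 / ω₂ + 2 / ω₂ ^ 2) + N * (2 * (3 + β)) + γ * 2)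
      zero_le_one zero_le_one (by positivity) (fun y => by rw [one_mul]; exact hpb y x) (hd 0) (hd (Fin.last N)) bℓ t ht
    rw [pinnedChain_integral_momentum_zero_mul_momentum ω₂ lam β γ hω hl.le hβ.le N T hT x, sub_eq_iff_eq_add'] at h
    -- linearity inside the time integral
    have hlin : ∀ s : ℝ, kickResp ω₂ lam β γ T N ℓ s =
        -(ω₂ * posResp ω₂ lam β γ T N x s) - lam * cubeResp ω₂ lam β γ T N x s +
          (∑ b : Fin N, ((if (b : ℕ) = (x : ℕ) then bondForceResp ω₂ lam β γ T N b s else 0) -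
            (if (b : ℕ) + 1 = (x : ℕ) then bondForceResp ω₂ lam β γ T N b s else 0))) -
          γ * c * momResp ω₂ lam β γ T N x s := by
      intro s
      have e1 := kickResp_sub hω hl.le hβ hγ hT N (f := fun y => -(ω₂ * y.1 x) - lam * y.1 x ^ 3 + S y)
        (g := fun y => γ * c * y.2 x) hAc hGc bA bG s
      have e2 := kickResp_add hω hl.le hβ hγ hT N (f := fun y => -(ω₂ * y.1 x) - lam * y.1 x ^ 3) (g := S)
        hA1c hSc bA1 bS s
      have e3 := kickResp_sub hω hl.le hβ hγ hT N (f := fun y => -(ω₂ * y.1 x)) (g := fun y => lam * y.1 x ^ 3)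
        (by fun_prop) (by fun_prop) bq bq3 s
      have e4 := kickResp_finset_sum hω hl.le hβ hγ hT N Finset.univ
        (f := fun (b : Fin N) (y : PhaseSpace (N + 1)) =>
          (if (b : ℕ) = (x : ℕ) then F b y else 0) - (if (b : ℕ) + 1 = (x : ℕ) then F b y else 0))
        (fun b _ => hSbc b) (fun b _ => ⟨2 * (3 + β), bSb b⟩) s
      have e5 : ∀ b : Fin N, kickResp ω₂ lam β γ T N (fun y =>
          (if (b : ℕ) = (x : ℕ) then F b y else 0) - (if (b : ℕ) + 1 = (x : ℕ) then F b y else 0)) s =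
          (if (b : ℕ) = (x : ℕ) then bondForceResp ω₂ lam β γ T N b s else 0) -
            (if (b : ℕ) + 1 = (x : ℕ) then bondForceResp ω₂ lam β γ T N b s else 0) := fun b => by
        rw [kickResp_sub hω hl.le hβ hγ hT N (f := fun y => if (b : ℕ) = (x : ℕ) then F b y else 0)
          (g := fun y => if (b : ℕ) + 1 = (x : ℕ) then F b y else 0) (hi1c b) (hi2c b) (bi1 b) (bi2 b) s,
          kickResp_ite, kickResp_ite]
        rfl
      have e6 : kickResp ω₂ lam β γ T N (fun y => -(ω₂ * y.1 x)) s = -(ω₂ * posResp ω₂ lam β γ T N x s) := by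
        rw [kickResp_neg, kickResp_const_mul]; rfl
      have e7 : kickResp ω₂ lam β γ T N (fun y => lam * y.1 x ^ 3) s = lam * cubeResp ω₂ lam β γ T N x s := by
        rw [kickResp_const_mul]; rfl
      have e8 : kickResp ω₂ lam β γ T N (fun y => γ * c * y.2 x) s = γ * c * momResp ω₂ lam β γ T N x s := by
        rw [kickResp_const_mul]; rfl
      have eS : kickResp ω₂ lam β γ T N S s =
          ∑ b : Fin N, ((if (b : ℕ) = (x : ℕ) then bondForceResp ω₂ lam β γ T N b s else 0) -
            (if (b : ℕ) + 1 = (x : ℕ) then bondForceResp ω₂ lam β γ T N b s else 0)) := by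
        simp only [hS]
        rw [e4]
        exact Finset.sum_congr rfl fun b _ => e5 b
      calc kickResp ω₂ lam β γ T N ℓ s
          = kickResp ω₂ lam β γ T N (fun y => (-(ω₂ * y.1 x) - lam * y.1 x ^ 3 + S y) - γ * c * y.2 x) s := rfl
        _ = _ := by rw [e1, e2, e3, e6, e7, e8, eS]
    rw [show momResp ω₂ lam β γ T N x t = kickResp ω₂ lam β γ T N (fun y : PhaseSpace (N + 1) => y.2 x) t from rfl, h]
    congr 1
    refine intervalIntegral.integral_congr fun s _ => ?_
    exact hlin s

end Main
end Summit.AtomisticToContinuum.FouriersLaw.Theorems.CoherentDephasing.MeanFieldDuhamel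

end
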